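import Literature.AnabelianGeometry.AbsoluteAnabelian.ZHatCompletionFreeProcyclic

/-!
# `[Ẑ : Ẑ^n] = n`: in a free procyclic compact group the `n`-th powers form the subgroup of index `n`

[AbsTopI] §0 p. 7 ("The profinite completion of the group `ℤ` will be denoted `Ẑ`") and [AbsTopIII]
Prop. 1.4 (i) p. 31 (a cuspidal inertia group "is naturally isomorphic to `Ẑ(1)`") are typed in the cell by
abc-iut-L4-t1's intrinsic predicate `FundamentalExtension.IsFreeProcyclic` (a dense cyclic subgroup; an open
subgroup of every positive index), validated by abc-iut-L4-t6's structure theorem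
(`FreeProcyclicStructure.lean`: `≅ ∏_p ℤ_p`).  This PROOF-ONLY file (no definitions; seat abc-iut-L6-t19 gen 5)
adds the one index computation downstream typings quote as "the `Ẑ(1)`-shape of an inertia group": for a
compact Hausdorff group `G` with `IsFreeProcyclic G` and `n ≥ 1`,

* `closure_pow_image_eq_closureZpowersPow` — the ABSTRACT subgroup `G^n` generated by all `n`-th powers IS
  abc-iut-L4-t6's `closure ⟨gⁿ⟩` (the unique open subgroup of index `n`): `G` is commutative
  (`mul_comm_of_dense_zpowers`), so the `n`-th powers form a subgroup, which is the continuous image of the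
  compact `G`, hence closed; it contains `gⁿ`; conversely `xⁿ ∈ closure ⟨gⁿ⟩` because that subgroup has
  index `n` (`Subgroup.pow_index_mem`);
* **`FundamentalExtension.IsFreeProcyclic.index_closure_pow_image`** — `[G : G^n] = n`;
* **`FundamentalExtension.IsFreeProcyclic.relIndex_closure_pow_image`** — the SUBGROUP form consumers need:
  for a subgroup `I` of a Hausdorff topological group, compact and free procyclic in the subspace topology,
  `[I : I^n] = n` with `I^n := Subgroup.closure {xⁿ : x ∈ I}` taken in the ambient group (e.g. hypothesis
  `hZ` of abc-iut-L6-t19's `Literature.IUT.HodgeArakelov.rmk231_powers_of_inputs`, [IUTchII] Rmk. 2.3.1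
  "`I ∩ Π_⊆ = I^l`");
* `relIndex_closure_pow_image_of_continuousMulEquiv_zHat` — the same in the `≃ₜ* Ẑ` vocabulary (Mathlib's
  profinite completion of `ℤ` = the tree's `SemiGraphs.ZHat` of abc-iut-L3's `TemperedCurve.inertia_equiv_zHat`
  and `IUT.HodgeTheaters.ZHat`), via abc-iut-L4's bridge `ZHatCompletionFreeProcyclic.lean`.

HONEST FRAMING: classical profinite group theory; nothing here bears on [IUTchIII] Cor. 3.12.
-/

noncomputable section

open ProfiniteGrp ProfiniteGrp.ProfiniteCompletion

namespace Literature.AnabelianGeometry.AbsoluteAnabelian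

universe u

variable {G : Type u} [Group G] [TopologicalSpace G] [IsTopologicalGroup G]

/-- In a compact Hausdorff group with dense `⟨g⟩` and an open subgroup of index `n ≥ 1`, the abstract subgroup
generated by ALL `n`-th powers equals `closure ⟨gⁿ⟩` (abc-iut-L4-t6's open subgroup of index `n`).
[cite: MochizukiAbsTopI2012, §0 p.7] -/
theorem closure_pow_image_eq_closureZpowersPow [CompactSpace G] [T2Space G] {g : G}
    (hg : Dense (Subgroup.zpowers g : Set G)) {n : ℕ} (hn : 0 < n)
    (hex : ∃ H : Subgroup G, IsOpen (H : Set G) ∧ H.index = n) :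
    Subgroup.closure ((fun x : G => x ^ n) '' (Set.univ : Set G)) =
      (Subgroup.zpowers (g ^ n)).topologicalClosure := by
  have hcomm : ∀ a b : G, a * b = b * a := mul_comm_of_dense_zpowers hg
  set K := (Subgroup.zpowers (g ^ n)).topologicalClosure with hK
  have hKidx : K.index = n := (isOpen_closureZpowersPow hg hn hex).2
  haveI : K.Normal := ⟨fun x hx y => by rwa [hcomm y x, mul_inv_cancel_right]⟩
  -- the `n`-th powers form a subgroup (commutativity), closed (continuous image of a compact space)
  let Pn : Subgroup G :=
    { carrier := (fun x : G => x ^ n) '' (Set.univ : Set G)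
      one_mem' := ⟨1, Set.mem_univ _, one_pow n⟩
      mul_mem' := by
        rintro _ _ ⟨a, -, rfl⟩ ⟨b, -, rfl⟩
        have hc : Commute a b := hcomm a b
        exact ⟨a * b, Set.mem_univ _, hc.mul_pow n⟩
      inv_mem' := by
        rintro _ ⟨a, -, rfl⟩
        exact ⟨a⁻¹, Set.mem_univ _, inv_pow a n⟩ }
  have hPn : Subgroup.closure ((fun x : G => x ^ n) '' (Set.univ : Set G)) = Pn :=
    Subgroup.closure_eq Pn
  have hclosed : IsClosed (Pn : Set G) :=
    ((isCompact_univ (X := G)).image (continuous_pow n)).isClosed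
  refine le_antisymm ?_ ?_
  · -- `xⁿ ∈ K` since `[G : K] = n`
    rw [Subgroup.closure_le]
    rintro _ ⟨x, -, rfl⟩
    have h := Subgroup.pow_index_mem K x
    rwa [hKidx] at h
  · -- `K = closure ⟨gⁿ⟩ ≤ Pn` since `gⁿ ∈ Pn` and `Pn` is closed
    rw [hPn, hK]
    refine Subgroup.topologicalClosure_minimal _ ?_ hclosed
    rw [Subgroup.zpowers_le]
    exact ⟨g, Set.mem_univ _, rfl⟩

/-- **`[G : G^n] = n` for a free procyclic compact Hausdorff group** ("`≅ Ẑ`", [AbsTopI] §0 p. 7; the inertia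
group `I_x ≅ Ẑ(1)` of [AbsTopIII] Prop. 1.4 (i) p. 31): the subgroup generated by the `n`-th powers has index
`n`, for every `n ≥ 1`. [cite: MochizukiAbsTopIII2015, Prop 1.4 (i) p.31] -/
theorem FundamentalExtension.IsFreeProcyclic.index_closure_pow_image [CompactSpace G] [T2Space G]
    (h : FundamentalExtension.IsFreeProcyclic G) {n : ℕ} (hn : 0 < n) :
    (Subgroup.closure ((fun x : G => x ^ n) '' (Set.univ : Set G))).index = n := by
  obtain ⟨g, hg⟩ := h.exists_dense_zpowers
  rw [closure_pow_image_eq_closureZpowersPow hg hn (h.exists_isOpen_index n hn)]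
  exact (isOpen_closureZpowersPow hg hn (h.exists_isOpen_index n hn)).2

/-- **`[I : I^n] = n`, subgroup form**: for a subgroup `I` of a Hausdorff topological group `Γ` that is compact and
free procyclic in the subspace topology (an inertia group `I_x ≅ Ẑ(1)` inside `Π`, [AbsTopIII] Prop. 1.4 (i)
p. 31), the subgroup of `Γ` generated by the `n`-th powers of the elements of `I` has relative index `n` in `I`,
for every `n ≥ 1`. [cite: MochizukiAbsTopIII2015, Prop 1.4 (i) p.31] -/
theorem FundamentalExtension.IsFreeProcyclic.relIndex_closure_pow_image {Γ : Type u} [Group Γ]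
    [TopologicalSpace Γ] [IsTopologicalGroup Γ] [T2Space Γ] (I : Subgroup Γ) [CompactSpace I]
    (h : FundamentalExtension.IsFreeProcyclic I) {n : ℕ} (hn : 0 < n) :
    (Subgroup.closure ((fun x : Γ => x ^ n) '' (I : Set Γ))).relIndex I = n := by
  have hset : ((fun x : Γ => x ^ n) '' (I : Set Γ)) =
      I.subtype '' ((fun x : I => x ^ n) '' (Set.univ : Set I)) := by
    ext y
    constructor
    · rintro ⟨x, hx, rfl⟩
      exact ⟨⟨x, hx⟩ ^ n, ⟨⟨x, hx⟩, Set.mem_univ _, rfl⟩, by simp⟩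
    · rintro ⟨_, ⟨x, -, rfl⟩, rfl⟩
      exact ⟨x, x.2, by simp⟩
  rw [hset, ← MonoidHom.map_closure, Subgroup.relIndex, ← Subgroup.comap_subtype,
    Subgroup.comap_map_eq_self_of_injective (Subgroup.subtype_injective I)]
  exact h.index_closure_pow_image hn

/-- **`[I : I^n] = n` for a subgroup `I ≃ₜ* Ẑ`** of a Hausdorff topological group — the "`≅ Ẑ(1)`" vocabulary
of [SemiAnbd] §6 p. 71 / [AbsTopIII] Prop. 1.4 (i) p. 31 as abc-iut-L3 (`TemperedCurve.inertia_equiv_zHat`) and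
abc-iut-L5/L6 (`IUT.HodgeTheaters.ZHat`) spell it, `Ẑ` being Mathlib's profinite completion of `ℤ`: the subgroup
generated by the `n`-th powers of the elements of `I` has relative index `n` in `I` (`n ≥ 1`).
[cite: MochizukiAbsTopIII2015, Prop 1.4 (i) p.31] -/
theorem relIndex_closure_pow_image_of_continuousMulEquiv_zHat {Γ : Type u} [Group Γ]
    [TopologicalSpace Γ] [IsTopologicalGroup Γ] [T2Space Γ] (I : Subgroup Γ)
    (e : I ≃ₜ* completion (GrpCat.of (Multiplicative ℤ))) {n : ℕ} (hn : 0 < n) :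
    (Subgroup.closure ((fun x : Γ => x ^ n) '' (I : Set Γ))).relIndex I = n := by
  haveI : CompactSpace I := e.toHomeomorph.symm.compactSpace
  exact (FundamentalExtension.IsFreeProcyclic.of_continuousMulEquiv_zHatCompletion e)
    |>.relIndex_closure_pow_image I hn

end Literature.AnabelianGeometry.AbsoluteAnabelian

end
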